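import Summits.KontsevichZagierPeriods.KontsevichZagierPeriods.Theorems.LinRedNormalFormArrangementNormalFormStubRebaseSimplePosProduct
import Summits.KontsevichZagierPeriods.KontsevichZagierPeriods.Theorems.LinRedNormalFormArrangementNormalFormStubRebaseSimplePosOneFibreWedge

/-!
# Stub `stub_rebaseSimplePos`, part `rebaseSimplePos_oneFibre` (crux `ArrangementNormalForm`,
line `janus-bands`, v6.2) — sub-part `Blow`

The BLOW-UP of a COAXIAL pinch, uniformly in the silent base coordinates (the any-dimension
version of `RebaseOne.band_blow`, rule 2 of the Kontsevich–Zagier calculus with a non-affine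
substitution). One lettered fibre `t` with letter `c(x', y)` and affine bounds `u < v` such that
`u − c` and `v − c` are rational multiples of ONE affine form: `u − c = A (v − u)` (hence
`v − c = (A + 1)(v − u)`), i.e. the two bounding hyperplanes and the letter hyperplane share an
axis. The substitution `t = c(x', y) + σ (v − u)(x', y)` (Jacobian `(v − u)(x', y) > 0`) maps the
literal cell `{rows, A < σ < A + 1}` onto the band, and the integrand
`g(x', y)/(t − c) · |∂t/∂σ| = g(x', y)/σ` is again literal, with letter `0` and CONSTANT bounds:
an element of `GG B 2 1` (`RebasePos.good_coaxial`; registered on the literal class text as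
`rebaseSimplePos_coaxial`). The calculus of the substitution: `RebasePos.blowInv` (the map),
`blowLin` (its derivative, the identity matrix with the `t`-row replaced), `blowLin_det`.

References: M. Kontsevich, D. Zagier, *Periods* (2001), §1.2, rule (2).
-/

noncomputable section

open Set MeasureTheory MvPolynomial Matrix
open Literature.NumberTheory.Transcendental Literature.ModelTheory.ExponentialFields

namespace Summit.KontsevichZagierPeriods.ArrangementNormalForm.JanusBands

namespace RebasePos

open SeparatePos

section Blow

variable {B : ℕ} (c φ : (Fin (B + 1) → ℚ) × ℚ)

/-- The fibre coordinate of the one-fibre text. -/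
abbrev tI (B : ℕ) : Fin (B + 1 + 1) := Fin.natAdd (B + 1) 0

/-- The blow-up substitution `t = c(x', y) + σ φ(x', y)` (base coordinates unchanged). -/
def blowInv (w : Fin (B + 1 + 1) → ℝ) : Fin (B + 1 + 1) → ℝ :=
  Function.update w (tI B) (affF B 1 c w + w (tI B) * affF B 1 φ w)

/-- The `t`-row of the derivative of `blowInv` at `w`. -/
def blowRow (w : Fin (B + 1 + 1) → ℝ) : Fin (B + 1 + 1) → ℝ :=
  Fin.append (fun j : Fin (B + 1) => (c.1 j : ℝ) + w (tI B) * (φ.1 j : ℝ))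
    (fun _ : Fin 1 => affF B 1 φ w)

/-- The matrix of the derivative of `blowInv` at `w`: the identity with the `t`-row replaced. -/
def blowMat (w : Fin (B + 1 + 1) → ℝ) : Matrix (Fin (B + 1 + 1)) (Fin (B + 1 + 1)) ℝ :=
  (1 : Matrix (Fin (B + 1 + 1)) (Fin (B + 1 + 1)) ℝ).updateRow (tI B) (blowRow c φ w)

/-- The derivative of `blowInv` at `w` as a continuous linear map. -/
def blowLin (w : Fin (B + 1 + 1) → ℝ) : (Fin (B + 1 + 1) → ℝ) →L[ℝ] (Fin (B + 1 + 1) → ℝ) :=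
  LinearMap.toContinuousLinearMap (Matrix.toLin' (blowMat c φ w))

/-- Base coordinates are not the fibre coordinate. -/
theorem castAdd_ne_tI (j : Fin (B + 1)) : Fin.castAdd 1 j ≠ tI B := by
  intro h
  have := congrArg Fin.val h
  simp at this
  omega

/-- `blowInv` fixes the base coordinates. -/
@[simp] theorem blowInv_base (w : Fin (B + 1 + 1) → ℝ) (j : Fin (B + 1)) :
    blowInv c φ w (Fin.castAdd 1 j) = w (Fin.castAdd 1 j) := by
  rw [blowInv, Function.update_of_ne (castAdd_ne_tI j)]

/-- `blowInv` on the fibre coordinate. -/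
@[simp] theorem blowInv_t (w : Fin (B + 1 + 1) → ℝ) :
    blowInv c φ w (tI B) = affF B 1 c w + w (tI B) * affF B 1 φ w := by
  rw [blowInv, Function.update_self]

/-- Full-base affine forms are unchanged by `blowInv`. -/
@[simp] theorem affF_blowInv (d : (Fin (B + 1) → ℚ) × ℚ) (w : Fin (B + 1 + 1) → ℝ) :
    affF B 1 d (blowInv c φ w) = affF B 1 d w := by
  simp [affF]

/-- `x'`-affine forms are unchanged by `blowInv`. -/
@[simp] theorem affB_blowInv (d : (Fin B → ℚ) × ℚ) (w : Fin (B + 1 + 1) → ℝ) :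
    affB B 1 d (blowInv c φ w) = affB B 1 d w := by
  simp [affB]

/-- `blowLin` in coordinates. -/
theorem blowLin_apply (w v : Fin (B + 1 + 1) → ℝ) :
    blowLin c φ w v = Function.update v (tI B) (blowRow c φ w ⬝ᵥ v) := by
  rw [blowLin, LinearMap.coe_toContinuousLinearMap', Matrix.toLin'_apply, blowMat,
    Matrix.updateRow_mulVec, Matrix.one_mulVec]

/-- The `t`-row paired with a vector. -/
theorem blowRow_dot (w v : Fin (B + 1 + 1) → ℝ) : blowRow c φ w ⬝ᵥ v =
    (∑ j : Fin (B + 1), ((c.1 j : ℝ) + w (tI B) * (φ.1 j : ℝ)) * v (Fin.castAdd 1 j)) +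
      affF B 1 φ w * v (tI B) := by
  simp [dotProduct, blowRow, Fin.sum_univ_add]

/-- The Jacobian determinant of `blowInv` is `φ(x', y)`. -/
theorem det_blowMat (w : Fin (B + 1 + 1) → ℝ) : (blowMat c φ w).det = affF B 1 φ w := by
  have h : blowRow c φ w = ∑ k, blowRow c φ w k • (1 : Matrix (Fin (B + 1 + 1)) (Fin (B + 1 + 1)) ℝ) k := by
    funext i
    simp [Finset.sum_apply, Matrix.one_apply]
  rw [blowMat, h, Matrix.det_updateRow_sum, Matrix.det_one, smul_eq_mul, mul_one]
  simp [blowRow]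

/-- The determinant of `blowLin`. -/
theorem blowLin_det (w : Fin (B + 1 + 1) → ℝ) : (blowLin c φ w).det = affF B 1 φ w := by
  rw [blowLin, ContinuousLinearMap.det, LinearMap.coe_toContinuousLinearMap, LinearMap.det_toLin',
    det_blowMat]

/-- The derivative of a full-base affine form. -/
theorem hasFDerivAt_affF (d : (Fin (B + 1) → ℚ) × ℚ) (w : Fin (B + 1 + 1) → ℝ) :
    HasFDerivAt (fun w : Fin (B + 1 + 1) → ℝ => affF B 1 d w)
      (∑ j : Fin (B + 1), (d.1 j : ℝ) • ContinuousLinearMap.proj (R := ℝ) (φ := fun _ : Fin (B + 1 + 1) => ℝ) (Fin.castAdd 1 j)) w := by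
  unfold affF
  exact (HasFDerivAt.fun_sum fun j _ =>
    (hasFDerivAt_apply (Fin.castAdd 1 j) w).const_mul (d.1 j : ℝ)).add_const _

/-- `blowInv` has derivative `blowLin`. -/
theorem hasFDerivAt_blowInv (w : Fin (B + 1 + 1) → ℝ) :
    HasFDerivAt (blowInv c φ) (blowLin c φ w) w := by
  refine hasFDerivAt_pi'' fun l => ?_
  by_cases hl : l = tI B
  · subst hl
    have hfun : (fun w : Fin (B + 1 + 1) → ℝ => blowInv c φ w (tI B)) =
        fun w => affF B 1 c w + w (tI B) * affF B 1 φ w := funext fun w => blowInv_t c φ w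
    rw [hfun]
    refine ((hasFDerivAt_affF c w).add ((hasFDerivAt_apply (tI B) w).fun_mul
      (hasFDerivAt_affF φ w))).congr_fderiv ?_
    ext v
    simp only [_root_.add_apply, _root_.smul_apply,
      FunLike.coe_sum, Finset.sum_apply, ContinuousLinearMap.proj_apply,
      smul_eq_mul, ContinuousLinearMap.coe_comp, Function.comp_apply, blowLin_apply,
      Function.update_self, blowRow_dot]
    simp only [affF, add_mul, Finset.sum_add_distrib, Finset.mul_sum]
    ring_nf
  · have hfun : (fun w : Fin (B + 1 + 1) → ℝ => blowInv c φ w l) = fun w => w l :=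
      funext fun w => by rw [blowInv, Function.update_of_ne hl]
    rw [hfun]
    refine (hasFDerivAt_apply l w).congr_fderiv ?_
    ext v
    simp [blowLin_apply, hl]

/-- `affF` depends only on the base coordinates. -/
theorem affF_congr_base (d : (Fin (B + 1) → ℚ) × ℚ) {w w' : Fin (B + 1 + 1) → ℝ}
    (h : ∀ j : Fin (B + 1), w (Fin.castAdd 1 j) = w' (Fin.castAdd 1 j)) : affF B 1 d w = affF B 1 d w' := by
  simp [affF, h]

/-- `affF` is unchanged by updating the fibre coordinate. -/
@[simp] theorem affF_update_tI (d : (Fin (B + 1) → ℚ) × ℚ) (z : Fin (B + 1 + 1) → ℝ) (x : ℝ) :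
    affF B 1 d (Function.update z (tI B) x) = affF B 1 d z :=
  affF_congr_base d fun j => by rw [Function.update_of_ne (castAdd_ne_tI j)]

/-- `affF` of a scalar multiple. -/
theorem affF_smul' (A : ℚ) (d : (Fin (B + 1) → ℚ) × ℚ) (z : Fin (B + 1 + 1) → ℝ) :
    affF B 1 (A • d) z = (A : ℝ) * affF B 1 d z := by
  simp only [affF, Prod.smul_fst, Prod.smul_snd, Pi.smul_apply, smul_eq_mul, Rat.cast_mul,
    Finset.mul_sum, mul_add]
  ring

/-- `affF` of a difference. -/
theorem affF_sub'' (d d' : (Fin (B + 1) → ℚ) × ℚ) (z : Fin (B + 1 + 1) → ℝ) :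
    affF B 1 (d - d') z = affF B 1 d z - affF B 1 d' z := by
  simp only [affF, Prod.fst_sub, Prod.snd_sub, Pi.sub_apply, Rat.cast_sub, sub_mul,
    Finset.sum_sub_distrib]
  ring

/-- `affF` of the zero form. -/
@[simp] theorem affF_zero'' (z : Fin (B + 1 + 1) → ℝ) : affF B 1 (0 : (Fin (B + 1) → ℚ) × ℚ) z = 0 := by
  simp [affF]

/-- `affF` of a constant form. -/
@[simp] theorem affF_const (A : ℚ) (z : Fin (B + 1 + 1) → ℝ) :
    affF B 1 ((0 : Fin (B + 1) → ℚ), A) z = A := by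
  simp [affF]

/-- `blowInv` as a polynomial map. -/
def blowPoly : Fin (B + 1 + 1) → MvPolynomial (Fin (B + 1 + 1)) ℚ :=
  Fin.append (fun j => X (Fin.castAdd 1 j)) (fun _ => affFPoly c + X (tI B) * affFPoly φ)

/-- `blowPoly` evaluates to `blowInv`. -/
theorem aeval_blowPoly (w : Fin (B + 1 + 1) → ℝ) :
    (fun l => aeval w (blowPoly c φ l)) = blowInv c φ w := by
  funext l
  refine Fin.addCases (fun j => ?_) (fun i => ?_) l
  · simp [blowPoly]
  · have hi : Fin.natAdd (B + 1) i = tI B := by rw [Subsingleton.elim i 0]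
    simp only [blowPoly, Fin.append_right, map_add, map_mul, aeval_X, aeval_affFPoly, hi, blowInv_t]

/-- Coordinatewise bounded sets are bounded. -/
theorem isBounded_of_forall_abs_le {n : ℕ} {S : Set (Fin n → ℝ)} (R : ℝ)
    (h : ∀ w ∈ S, ∀ l, |w l| ≤ R) : Bornology.IsBounded S := by
  rw [isBounded_iff_forall_norm_le]
  refine ⟨max R 0, fun w hw => ?_⟩
  rw [pi_norm_le_iff_of_nonneg (le_max_right _ _)]
  intro l
  rw [Real.norm_eq_abs]
  exact (h w hw l).trans (le_max_left _ _)

variable {m m' : ℕ}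

/-- **The blow-up of a coaxial pinch** (rule 2 with `t = c(x', y) + σ (v − u)(x', y)`). See the
module docstring. -/
theorem blowUp (s : KZ.IntegralRep (B + 1 + 1)) (M : Fin m' → (Fin (B + 1) → ℚ) × ℚ)
    (L : Fin m → (Fin B → ℚ) × ℚ) (e : Fin m → ℕ) (p : MvPolynomial (Fin B) ℚ)
    (ℓ₁ ℓ₂ : (Fin B → ℚ) × ℚ) (n₁ n₂ : ℕ) (u v : (Fin (B + 1) → ℚ) × ℚ) (A : ℚ)
    (hbd : Bornology.IsBounded s.domain)
    (hdom : s.domain = gDom B 1 m' M (fun _ => Sum.inr u) (fun _ => Sum.inr v))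
    (hint : EqOn s.integrand (glit B 1 p L e ℓ₁ ℓ₂ n₁ n₂ (fun _ => some c)) s.domain)
    (hφ : φ = v - u) (hA : u - c = A • (v - u))
    (huv : ∀ z : Fin (B + 1 + 1) → ℝ, (∀ j, 0 < affF B 1 (M j) z) → affF B 1 u z < affF B 1 v z) :
    ∃ s' : KZ.IntegralRep (B + 1 + 1), Bornology.IsBounded s'.domain ∧
      s'.domain = gDom B 1 m' M (fun _ => Sum.inr ((0 : Fin (B + 1) → ℚ), A))
        (fun _ => Sum.inr ((0 : Fin (B + 1) → ℚ), A + 1)) ∧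
      EqOn s'.integrand (glit B 1 p L e ℓ₁ ℓ₂ n₁ n₂ (fun _ => some 0)) s'.domain ∧
      KZ.of s - KZ.of s' ∈ KZ.relations := by
  set R : Set (Fin (B + 1 + 1) → ℝ) := gDom B 1 m' M (fun _ => Sum.inr ((0 : Fin (B + 1) → ℚ), A))
    (fun _ => Sum.inr ((0 : Fin (B + 1) → ℚ), A + 1)) with hR
  set f' := glit B 1 p L e ℓ₁ ℓ₂ n₁ n₂ (fun _ => some (0 : (Fin (B + 1) → ℚ) × ℚ)) with hf'
  -- affine identities
  have hφpos : ∀ z : Fin (B + 1 + 1) → ℝ, (∀ j, 0 < affF B 1 (M j) z) → 0 < affF B 1 φ z :=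
    fun z hz => by rw [hφ, affF_sub'']; linarith [huv z hz]
  have huc : ∀ z : Fin (B + 1 + 1) → ℝ, affF B 1 u z - affF B 1 c z = (A : ℝ) * affF B 1 φ z :=
    fun z => by
      have key := congrArg (fun q => affF B 1 q z) hA
      simp only [affF_sub'', affF_smul'] at key
      rw [hφ, affF_sub'']
      exact key
  have hvc : ∀ z : Fin (B + 1 + 1) → ℝ, affF B 1 v z - affF B 1 c z = ((A : ℝ) + 1) * affF B 1 φ z :=
    fun z => by
      have h1 := huc z
      rw [hφ, affF_sub''] at h1 ⊢
      linarith
  -- membership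
  have hmemR : ∀ w, w ∈ R ↔ (∀ j, 0 < affF B 1 (M j) w) ∧ (A : ℝ) < w (tI B) ∧ w (tI B) < (A : ℝ) + 1 := by
    intro w
    rw [hR, mem_gDom_one, affF_const, affF_const, Rat.cast_add, Rat.cast_one]
  have hmemD : ∀ z, z ∈ s.domain ↔ (∀ j, 0 < affF B 1 (M j) z) ∧ affF B 1 u z < z (tI B) ∧
      z (tI B) < affF B 1 v z := fun z => by rw [hdom, mem_gDom_one]
  have hΨdom : ∀ w, w ∈ R ↔ blowInv c φ w ∈ s.domain := by
    intro w
    rw [hmemR, hmemD]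
    simp only [affF_blowInv, blowInv_t]
    refine and_congr_right fun hrow => ?_
    have hp := hφpos w hrow
    have h1 := huc w
    have h2 := hvc w
    constructor
    · rintro ⟨ha, hb⟩; constructor <;> nlinarith
    · rintro ⟨ha, hb⟩
      constructor
      · nlinarith
      · nlinarith
  -- the inverse
  set Φ : (Fin (B + 1 + 1) → ℝ) → (Fin (B + 1 + 1) → ℝ) := fun z =>
    Function.update z (tI B) ((z (tI B) - affF B 1 c z) / affF B 1 φ z) with hΦ
  have hΨΦ : ∀ z ∈ s.domain, blowInv c φ (Φ z) = z := by
    intro z hz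
    have hp : affF B 1 φ z ≠ 0 := (hφpos z ((hmemD z).1 hz).1).ne'
    funext l
    by_cases hl : l = tI B
    · subst hl
      rw [blowInv_t]
      simp only [hΦ, affF_update_tI, Function.update_self]
      field_simp
      ring
    · rw [blowInv, Function.update_of_ne hl]
      simp only [hΦ, Function.update_of_ne hl]
  have himage : blowInv c φ '' R = s.domain := by
    ext z
    constructor
    · rintro ⟨w, hw, rfl⟩
      exact (hΨdom w).1 hw
    · intro hz
      exact ⟨Φ z, (hΨdom _).2 (by rw [hΨΦ z hz]; exact hz), hΨΦ z hz⟩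
  have hinj : InjOn (blowInv c φ) R := by
    intro w hw w' hw' h
    have hbase : ∀ j : Fin (B + 1), w (Fin.castAdd 1 j) = w' (Fin.castAdd 1 j) := fun j => by
      have := congrFun h (Fin.castAdd 1 j)
      rwa [blowInv_base, blowInv_base] at this
    have hc' : affF B 1 c w = affF B 1 c w' := affF_congr_base c hbase
    have hφ' : affF B 1 φ w = affF B 1 φ w' := affF_congr_base φ hbase
    have ht := congrFun h (tI B)
    rw [blowInv_t, blowInv_t, hc', hφ'] at ht
    have hp : affF B 1 φ w' ≠ 0 := (hφpos w' ((hmemR w').1 hw').1).ne'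
    have ht' : w (tI B) = w' (tI B) := mul_right_cancel₀ hp (by linarith)
    funext l
    refine Fin.addCases (fun j => hbase j) (fun i => ?_) l
    rw [show Fin.natAdd (B + 1) i = tI B by rw [Subsingleton.elim i 0]]
    exact ht'
  -- the new integrand is the old one after substitution times the Jacobian
  have hff' : ∀ w ∈ R, f' w = s.integrand (blowInv c φ w) * |(blowLin c φ w).det| := by
    intro w hw
    have hrow := ((hmemR w).1 hw).1
    have hp := hφpos w hrow
    rw [hint ((hΨdom w).1 hw), blowLin_det, abs_of_pos hp, hf', glit_one, glit_one]
    simp only [affB_blowInv, blowInv_base, affF_blowInv, blowInv_t, affF_zero'', sub_zero]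
    rw [add_sub_cancel_left]
    set G := MvPolynomial.aeval (fun i => w (Fin.castAdd 1 (Fin.castSucc i))) p /
      (∏ j, (affB B 1 (L j) w) ^ e j) *
      ((w (Fin.castAdd 1 (Fin.last B)) - affB B 1 ℓ₁ w) ^ n₁ /
        (w (Fin.castAdd 1 (Fin.last B)) - affB B 1 ℓ₂ w) ^ n₂) with hG
    rcases eq_or_ne (w (tI B)) 0 with h0 | h0
    · rw [show w (Fin.natAdd (B + 1) 0) = w (tI B) from rfl, h0]
      simp
    · rw [show w (Fin.natAdd (B + 1) 0) = w (tI B) from rfl]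
      field_simp
  -- semialgebraicity and calculus
  have hRsa : IsSemialgebraic ℚ R := isSemialgebraic_gDom _ _ _ _
  have hf'sa : IsSemialgebraicFunOn ℚ R f' := isSemialgebraicFunOn_glit hRsa _ L e ℓ₁ ℓ₂ n₁ n₂ _
  have hΨsa : IsSemialgebraicMapOn ℚ R (blowInv c φ) :=
    (isSemialgebraicMapOn_aeval hRsa (blowPoly c φ)).congr fun w _ => aeval_blowPoly c φ w
  have hderiv : ∀ w ∈ R, HasFDerivWithinAt (blowInv c φ) (blowLin c φ w) R w := fun w _ =>
    (hasFDerivAt_blowInv c φ w).hasFDerivWithinAt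
  have hRm : MeasurableSet R := IsSemialgebraic.measurableSet_holds hRsa
  have hf'int : IntegrableOn f' R := by
    have h1 : IntegrableOn (fun w => |(blowLin c φ w).det| • s.integrand (blowInv c φ w)) R :=
      (integrableOn_image_iff_integrableOn_abs_det_fderiv_smul volume hRm hderiv hinj
        s.integrand).1 (by rw [himage]; exact s.integrableOn)
    refine h1.congr_fun (fun w hw => ?_) hRm
    show |(blowLin c φ w).det| • s.integrand (blowInv c φ w) = f' w
    rw [smul_eq_mul, hff' w hw, mul_comm]
  let s' : KZ.IntegralRep (B + 1 + 1) := ⟨R, f', hRsa, hf'sa, hf'int⟩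
  have hcov : KZ.of s' - KZ.of s ∈ KZ.relations :=
    KZ.changeOfVariablesRel_subset_relations ⟨B + 1 + 1, s', s, blowInv c φ, fun w => blowLin c φ w,
      hΨsa, hderiv, hinj, himage.symm, fun w hw => hff' w hw, rfl⟩
  refine ⟨s', ?_, rfl, fun w _ => rfl, ?_⟩
  · -- boundedness
    obtain ⟨RD, -, hRD⟩ := hbd.exists_pos_norm_le
    refine isBounded_of_forall_abs_le (max RD (|(A : ℝ)| + |(A : ℝ) + 1|)) fun w hw l => ?_
    refine Fin.addCases (fun j => ?_) (fun i => ?_) l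
    · have h1 := hRD _ ((hΨdom w).1 hw)
      have h2 := norm_le_pi_norm (blowInv c φ w) (Fin.castAdd 1 j)
      rw [Real.norm_eq_abs, blowInv_base] at h2
      exact (h2.trans h1).trans (le_max_left _ _)
    · rw [show Fin.natAdd (B + 1) i = tI B by rw [Subsingleton.elim i 0]]
      obtain ⟨-, ha, hb⟩ := (hmemR w).1 hw
      refine le_trans ?_ (le_max_right _ _)
      rw [abs_le]
      constructor <;> linarith [neg_abs_le (A : ℝ), le_abs_self (A : ℝ), neg_abs_le ((A : ℝ) + 1),
        le_abs_self ((A : ℝ) + 1)]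
  · have := KZ.relations.neg_mem hcov
    rwa [neg_sub] at this

/-- **A coaxial pinch is good**: after the blow-up the representation is literally in
`GG B 2 1` (letter `0`, constant bounds `A < σ < A + 1`). -/
theorem good_coaxial (s : KZ.IntegralRep (B + 1 + 1)) (M : Fin m' → (Fin (B + 1) → ℚ) × ℚ)
    (L : Fin m → (Fin B → ℚ) × ℚ) (e : Fin m → ℕ) (p : MvPolynomial (Fin B) ℚ)
    (ℓ₁ ℓ₂ : (Fin B → ℚ) × ℚ) (n₁ n₂ : ℕ) (u v : (Fin (B + 1) → ℚ) × ℚ) (A : ℚ)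
    (h12 : n₁ = 0 ∨ n₂ = 0) (hbd : Bornology.IsBounded s.domain)
    (hdom : s.domain = gDom B 1 m' M (fun _ => Sum.inr u) (fun _ => Sum.inr v))
    (hint : EqOn s.integrand (glit B 1 p L e ℓ₁ ℓ₂ n₁ n₂ (fun _ => some c)) s.domain)
    (hA : u - c = A • (v - u))
    (huv : ∀ z : Fin (B + 1 + 1) → ℝ, (∀ j, 0 < affF B 1 (M j) z) → affF B 1 u z < affF B 1 v z) :
    ∃ c' ∈ AddSubgroup.closure (GGset B 2 1), KZ.of s - c' ∈ KZ.relations := by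
  obtain ⟨s', hbd', hdom', hint', hrel⟩ := blowUp c (v - u) s M L e p ℓ₁ ℓ₂ n₁ n₂ u v A hbd hdom
    hint rfl hA huv
  refine ⟨KZ.of s', AddSubgroup.subset_closure (mem_GGset_two s' M L e p ℓ₁ ℓ₂ _ _ _ h12
    (fun i c' hc' => ?_) (fun i c' hc' => ?_) hbd' hdom' hint'), hrel⟩
  · cases hc'; rfl
  · rcases hc' with h | h <;> cases h <;> exact Or.inl rfl

end Blow

end RebasePos

/-- **Registered part of `stub_rebaseSimplePos` / `rebaseSimplePos_oneFibre` (line `janus-bands`,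
v6.2): the coaxial pinch.** A one-fibre literal representation over a base of dimension `B + 1`
(letter `c(x', y)`, affine bounds `u < v` on the base cell, exponents `n₁ n₂` with
`n₁ = 0 ∨ n₂ = 0`) whose bounds are COAXIAL with the letter, `u − c = A (v − u)` as affine forms,
is congruent modulo `KZ.relations` to an element of `GG B 2 1`: the blow-up
`t = c + σ (v − u)` (rule 2, Jacobian `v − u`) turns it into the literal cell
`{rows, A < σ < A + 1}` with letter `0` (`RebasePos.good_coaxial`). This is the any-dimension
version of the pinch blow-up of `stub_rebaseOne` (apex ON the letter hyperplane); no shear of the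
letter is needed. -/
theorem rebaseSimplePos_coaxial (B m m' n₁ n₂ : ℕ) (s : KZ.IntegralRep (B + 1 + 1)) (M : Fin m' → (Fin (B + 1) → ℚ) × ℚ) (L : Fin m → (Fin B → ℚ) × ℚ) (e : Fin m → ℕ) (p : MvPolynomial (Fin B) ℚ) (ℓ₁ ℓ₂ : (Fin B → ℚ) × ℚ) (c u v : (Fin (B + 1) → ℚ) × ℚ) (A : ℚ) (h12 : n₁ = 0 ∨ n₂ = 0) (hbd : Bornology.IsBounded s.domain) (hdom : s.domain = {z | (∀ j, 0 < ∑ i, ((M j).1 i : ℝ) * z (Fin.castAdd 1 i) + ((M j).2 : ℝ)) ∧ ∀ i, Sum.elim (fun j => z (Fin.natAdd (B + 1) j)) (fun c => ∑ i', (c.1 i' : ℝ) * z (Fin.castAdd 1 i') + (c.2 : ℝ)) (Sum.inr u : Fin 1 ⊕ ((Fin (B + 1) → ℚ) × ℚ)) < z (Fin.natAdd (B + 1) i) ∧ z (Fin.natAdd (B + 1) i) < Sum.elim (fun j => z (Fin.natAdd (B + 1) j)) (fun c => ∑ i', (c.1 i' : ℝ) * z (Fin.castAdd 1 i') + (c.2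 : ℝ)) (Sum.inr v : Fin 1 ⊕ ((Fin (B + 1) → ℚ) × ℚ))}) (hint : EqOn s.integrand (fun z => MvPolynomial.aeval (fun i => z (Fin.castAdd 1 (Fin.castSucc i))) p / (∏ j, (∑ i, ((L j).1 i : ℝ) * z (Fin.castAdd 1 (Fin.castSucc i)) + ((L j).2 : ℝ)) ^ e j) * ((z (Fin.castAdd 1 (Fin.last B)) - (∑ i, (ℓ₁.1 i : ℝ) * z (Fin.castAdd 1 (Fin.castSucc i)) + (ℓ₁.2 : ℝ))) ^ n₁ / (z (Fin.castAdd 1 (Fin.last B)) - (∑ i, (ℓ₂.1 i : ℝ) * z (Fin.castAdd 1 (Fin.castSucc i)) + (ℓ₂.2 : ℝ))) ^ n₂) * ∏ i : Fin 1, (1 / (z (Fin.natAdd (B + 1) i) - (∑ i', (c.1 i' : ℝ) * z (Fin.castAdd 1 i') + (c.2 : ℝ))))) s.domain) (hA : u - c = A • (v - u)) (huv : ∀ z : Fin (B + 1 + 1) → ℝ, (∀ j, 0 < ∑ i, ((M j).1 i : ℝ) * z (Fin.castAdd 1 i) + ((M j).2 : ℝ)) → (∑ i, ((u).1 i : ℝ)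 * z (Fin.castAdd 1 i) + ((u).2 : ℝ)) < (∑ i, ((v).1 i : ℝ) * z (Fin.castAdd 1 i) + ((v).2 : ℝ))) : ∃ c' ∈ AddSubgroup.closure (SeparatePos.GGset B 2 1), KZ.of s - c' ∈ KZ.relations :=
  RebasePos.good_coaxial c s M L e p ℓ₁ ℓ₂ n₁ n₂ u v A h12 hbd hdom hint hA huv


end Summit.KontsevichZagierPeriods.ArrangementNormalForm.JanusBands
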